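import Literature.ComputerArithmetic.Lefevre2005.SegmentGrid
import HarnessLib

/-!
# Lefèvre's Algorithm 2: the segment–grid algorithm with divisions

V. Lefèvre, *New Results on the Distance between a Segment and ℤ². Application to the Exact Rounding*,
ARITH-17 (2005) [Lefevre2005], **§3 "Replacing Subtractions by Divisions" and Algorithm 2** — the companion
of `Literature.ComputerArithmetic.Lefevre2005.SegmentGrid` (Algorithm 1, subtractive). Transcribed from the
HAL author version (inria-00000025), p. 6:

```
Algorithm 2 — Still returns the first integer r ∈ ⟦0, N − 1⟧ such that {b − r.a} < d0 if there is one,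
else a value larger or equal to N, but this algorithm uses divisions.
Initialization: x = {a}; y = 1 − {a}; d = {b}; u = v = 1; r = 0;
if (d < d0) return 0
Unconditional loop:
  if (d < x)
    if (((x − d) ≫ c) ≥ y)
      q = ⌊(x − d)/y⌋ − 1;
      if (q ≥ N) return N
      x = x − q × y; v = v + q × u;
    if (c = 0 or (y ≫ c) > x)
      q = ⌊y/x⌋;
      if (q ≥ N) return N
      y = y − q × x;
      if (y = 0) return N
      u = u + q × v;
    else
      while (x < y)
        if (u + v ≥ N) return N
        y = y − x; u = u + v;
    if (u + v ≥ N) return N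
    x = x − y;
    if (x = 0) return N
    if (d ≥ x) r = r + v;
    v = v + u;
  else
    d = d − x;
    if (d < d0) return r + u
    if (c = 0 or (x ≫ c) > y)
      q = ⌊x/y⌋;
      if (q ≥ N) return N
      x = x − q × y;
      if (x = 0) return N
      v = v + q × u;
    else
      while (y < x)
        if (u + v ≥ N) return N
        x = x − y; v = v + u;
    if (u + v ≥ N) return N
    y = y − x;
    if (y = 0) return N
    if (d < x) r = r + u;
    u = u + v;
```
"`s ≫ c`" compares `s` shifted right by the small constant `c` ("a test `c = 0` has been added as a special
case to eliminate the comparison and force the division", [Lefevre2005, §3]); "Tests `x = 0` and `y = 0` have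
been added to avoid divisions by zero" (ibid.).

## What is here

* `algorithm2 c a b d₀ N` — the listing above, verbatim, over any linearly ordered field `K` with a floor
  function (the lengths are exact, as in `SegmentGrid`; `s ≫ c` is read exactly as `s / 2^c`, `shr` — with
  fixed-point lengths the shifted comparison may come out differently near ties, which only changes WHICH of
  the two correct paths is taken); the two subtractive `while` loops ARE the `loopY` / `loopX` of Algorithm 1.
  `batchX` = the first block (`q = ⌊(x − d)/y⌋ − 1` rounds of the `x`-branch at once), `divY` / `divX` = the
  divisions replacing the inner loops, `body2`, `loop2` (iteration bound, never reached).
* **THEOREM `algorithm2_spec`** — the caption, PROVED with no side condition, in the form of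
  `SegmentGrid.algorithm1_spec`: `r := algorithm2 c a b d₀ N < N ⟹ {b − r·a} < d₀`, and `d₀ ≤ {b − k·a}` for all
  `k < min r N`; `le_algorithm2_iff : N ≤ algorithm2 … ↔ ∀ k < N, d₀ ≤ {b − k·a}` (so `algorithm2` and
  `algorithm1` agree on the only thing the searches use, `algorithm2_ge_iff_algorithm1_ge`). The proof REUSES
  the invariants of Algorithm 1 (`XInv`, `YInv`, `HeadInv`, `Degenerate` and their one-step lemmas) and adds
  the `q`-fold iterations `XInv.stepY_iter`, `YInv.stepX_iter`, `XInv.roundX_iter` that one division stands for.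
* Recorded, as the paper does [Lefevre2005, §4, on Table 4]: "in Algorithm 2, divisions are not performed when
  the value of `d` (or `r`) would be modified, making it similar to subtractive algorithms; this could be a future
  improvement" — the rounds of the `else` branch that move `b`'s reference point one new point at a time are NOT
  batched, so a slope very close to a rational with small denominator can still cost many rounds, one per point
  placed next to `b`. Not transcribed: the timings of §4, the base-conversion application of §5.
-/

namespace Literature.ComputerArithmetic.Lefevre2005

variable {K : Type*} [Field K] [LinearOrder K] [IsStrictOrderedRing K] [FloorRing K]

/-! ### Algorithm 2, transcribed -/

/-- `s ≫ c` on lengths, read exactly: `s / 2^c`. [cite: Lefevre2005, §3] -/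
def shr (s : K) (c : ℕ) : K := s / 2 ^ c

/-- First block of the `x`-branch: `if (((x − d) ≫ c) ≥ y) { q = ⌊(x − d)/y⌋ − 1; if (q ≥ N) return N;
x = x − q × y; v = v + q × u; }` (`none` = "return N"). [cite: Lefevre2005, §3 Algorithm 2] -/
def batchX (c N : ℕ) (s : State K) : Option (State K) :=
  if s.y ≤ shr (s.x - s.d) c then
    if N ≤ ⌊(s.x - s.d) / s.y⌋₊ - 1 then none
    else some { s with x := s.x - ((⌊(s.x - s.d) / s.y⌋₊ - 1 : ℕ) : K) * s.y,
                       v := s.v + (⌊(s.x - s.d) / s.y⌋₊ - 1) * s.u }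
  else some s

/-- The division replacing the first inner loop: `if (c = 0 or (y ≫ c) > x) { q = ⌊y/x⌋; if (q ≥ N) return N;
y = y − q × x; if (y = 0) return N; u = u + q × v; } else while (x < y) {…}` — the `else` IS `loopY`.
[cite: Lefevre2005, §3 Algorithm 2] -/
def divY (c N : ℕ) (s : State K) : Option (State K) :=
  if c = 0 ∨ s.x < shr s.y c then
    if N ≤ ⌊s.y / s.x⌋₊ then none
    else if s.y - (⌊s.y / s.x⌋₊ : K) * s.x = 0 then none
    else some { s with y := s.y - (⌊s.y / s.x⌋₊ : K) * s.x, u := s.u + ⌊s.y / s.x⌋₊ * s.v }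
  else loopY N N s

/-- The division replacing the second inner loop: `if (c = 0 or (x ≫ c) > y) { q = ⌊x/y⌋; if (q ≥ N) return N;
x = x − q × y; if (x = 0) return N; v = v + q × u; } else while (y < x) {…}` (`loopX`).
[cite: Lefevre2005, §3 Algorithm 2] -/
def divX (c N : ℕ) (s : State K) : Option (State K) :=
  if c = 0 ∨ s.y < shr s.x c then
    if N ≤ ⌊s.x / s.y⌋₊ then none
    else if s.x - (⌊s.x / s.y⌋₊ : K) * s.y = 0 then none
    else some { s with x := s.x - (⌊s.x / s.y⌋₊ : K) * s.y, v := s.v + ⌊s.x / s.y⌋₊ * s.u }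
  else loopX N N s

/-- The body of the unconditional loop of Algorithm 2 (`Sum.inl r` = "return r", `Sum.inr s` = next round).
[cite: Lefevre2005, §3 Algorithm 2] -/
def body2 (c : ℕ) (d₀ : K) (N : ℕ) (s : State K) : ℕ ⊕ State K :=
  if s.d < s.x then
    match batchX c N s with
    | none => Sum.inl N
    | some s₁ =>
      match divY c N s₁ with
      | none => Sum.inl N
      | some t =>
        if N ≤ t.u + t.v then Sum.inl N
        else if t.x - t.y = 0 then Sum.inl N
        else Sum.inr { t with x := t.x - t.y, r := if t.x - t.y ≤ t.d then t.r + t.v else t.r,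
                              v := t.v + t.u }
  else
    if s.d - s.x < d₀ then Sum.inl (s.r + s.u)
    else
      match divX c N { s with d := s.d - s.x } with
      | none => Sum.inl N
      | some t =>
        if N ≤ t.u + t.v then Sum.inl N
        else if t.y - t.x = 0 then Sum.inl N
        else Sum.inr { t with y := t.y - t.x, r := if t.d < t.x then t.r + t.u else t.r,
                              u := t.u + t.v }

/-- The unconditional loop of Algorithm 2 with an iteration bound (never reached when `> N − (u + v)`).
[cite: Lefevre2005, §3 Algorithm 2] -/
def loop2 (c : ℕ) (d₀ : K) (N : ℕ) : ℕ → State K → ℕ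
  | 0, _ => N
  | fuel + 1, s =>
    match body2 c d₀ N s with
    | Sum.inl res => res
    | Sum.inr t => loop2 c d₀ N fuel t

/-- **Algorithm 2** of [Lefevre2005, §3] with shift count `c`: `x = {a}; y = 1 − {a}; d = {b}; u = v = 1; r = 0;
if (d < d₀) return 0;` then the unconditional loop. [cite: Lefevre2005, §3 Algorithm 2] -/
def algorithm2 (c : ℕ) (a b d₀ : K) (N : ℕ) : ℕ :=
  if Int.fract b < d₀ then 0
  else loop2 c d₀ N N ⟨Int.fract a, 1 - Int.fract a, Int.fract b, 1, 1, 0⟩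

/-! ### The `q`-fold steps one division stands for -/

section Iter

variable {a b d₀ : K} {N : ℕ}

/-- `q` iterations of the first inner loop at once (`y := y − q·x`, `u := u + q·v`) preserve `XInv` as long as
`q·x < y`. [cite: Lefevre2005, §3] -/
theorem XInv.stepY_iter {s : State K} (hs : XInv a b d₀ s) :
    ∀ q : ℕ, (q : K) * s.x < s.y → XInv a b d₀ { s with y := s.y - (q : K) * s.x, u := s.u + q * s.v }
  | 0, _ => by simpa using hs
  | q + 1, hq => by
    have hx := hs.cfg.x_pos
    have hq' : (q : K) * s.x < s.y := by push_cast at hq; linarith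
    have h1 := XInv.stepY_iter hs q hq'
    have h2 := h1.stepY (by dsimp only; push_cast at hq; linarith)
    dsimp only at h2
    have e1 : s.y - (q : K) * s.x - s.x = s.y - ((q + 1 : ℕ) : K) * s.x := by push_cast; ring
    have e2 : s.u + q * s.v + s.v = s.u + (q + 1) * s.v := by ring
    rw [e1, e2] at h2
    exact h2

/-- `q` iterations of the second inner loop at once preserve `YInv` as long as `q·y < x`.
[cite: Lefevre2005, §3] -/
theorem YInv.stepX_iter {s : State K} (hs : YInv a b d₀ s) :
    ∀ q : ℕ, (q : K) * s.y < s.x → YInv a b d₀ { s with x := s.x - (q : K) * s.y, v := s.v + q * s.u }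
  | 0, _ => by simpa using hs
  | q + 1, hq => by
    have hy := hs.cfg.y_pos
    have hq' : (q : K) * s.y < s.x := by push_cast at hq; linarith
    have h1 := YInv.stepX_iter hs q hq'
    have h2 := h1.stepX (by dsimp only; push_cast at hq; linarith)
    dsimp only at h2
    have e1 : s.x - (q : K) * s.y - s.y = s.x - ((q + 1 : ℕ) : K) * s.y := by push_cast; ring
    have e2 : s.v + q * s.u + s.u = s.v + (q + 1) * s.u := by ring
    rw [e1, e2] at h2
    exact h2

/-- One full round of the `x`-branch that leaves `d` and `r` alone (`y < x`, `b` stays left of the new point: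
`d < x − y`): `x := x − y`, `v := v + u`, and `XInv` again. [cite: Lefevre2005, §2.3, §3] -/
theorem XInv.roundX {s : State K} (hs : XInv a b d₀ s) (hyx : s.y < s.x) (hd : s.d < s.x - s.y) :
    XInv a b d₀ { s with x := s.x - s.y, v := s.v + s.u } := by
  have h := hs.split hyx
  have hc : ¬ s.x - s.y ≤ s.d := not_le.2 hd
  obtain ⟨hr, hdist, hchk⟩ := h.inX (by dsimp only; exact hd)
  dsimp only at hr hdist hchk
  rw [if_neg hc] at hr hdist
  refine ⟨?_, h.d₀_le, hd, hr, hdist, hchk⟩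
  have hcfg := h.cfg
  dsimp only at hcfg
  exact hcfg

/-- `q` such rounds at once (`x := x − q·y`, `v := v + q·u`), as long as `d < x − q·y`: the first block of
Algorithm 2. [cite: Lefevre2005, §3 Algorithm 2] -/
theorem XInv.roundX_iter {s : State K} (hs : XInv a b d₀ s) :
    ∀ q : ℕ, s.d < s.x - (q : K) * s.y → XInv a b d₀ { s with x := s.x - (q : K) * s.y, v := s.v + q * s.u }
  | 0, _ => by simpa using hs
  | q + 1, hq => by
    have hy := hs.cfg.y_pos
    have hd0 : 0 ≤ s.d := hs.dist_r ▸ Int.fract_nonneg _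
    have hq' : s.d < s.x - (q : K) * s.y := by push_cast at hq; linarith
    have h1 := XInv.roundX_iter hs q hq'
    have h2 := h1.roundX (by dsimp only; push_cast at hq; linarith) (by dsimp only; push_cast at hq; linarith)
    dsimp only at h2
    have e1 : s.x - (q : K) * s.y - s.y = s.x - ((q + 1 : ℕ) : K) * s.y := by push_cast; ring
    have e2 : s.v + q * s.u + s.u = s.v + (q + 1) * s.u := by ring
    rw [e1, e2] at h2
    exact h2

end Iter

/-! ### Correctness -/

section Spec

variable {a b d₀ : K} {N : ℕ} {c : ℕ}

omit [IsStrictOrderedRing K] in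
/-- "return N" is right as soon as `N` points are known to be at distance `≥ d₀`. [folklore] -/
private theorem returns_N_of_checked {s : State K} (hchk : ∀ k : ℕ, k < s.u + s.v → d₀ ≤ Int.fract (b - k * a))
    (hN : N ≤ s.u + s.v) : Returns a b d₀ N N :=
  ⟨fun h => absurd h (lt_irrefl _), fun k hk _ => hchk k (by omega)⟩

/-- The first block preserves `XInv` (it is `q` rounds of the `x`-branch with `b` untouched), or returns `N`
rightly. [cite: Lefevre2005, §3 Algorithm 2] -/
theorem batchX_spec {s : State K} (hs : XInv a b d₀ s) :
    (batchX c N s = none → Returns a b d₀ N N) ∧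
    (∀ t, batchX c N s = some t → XInv a b d₀ t ∧ t.d = s.d ∧ s.u + s.v ≤ t.u + t.v) := by
  have hx := hs.cfg.x_pos
  have hy := hs.cfg.y_pos
  have hd0 : 0 ≤ s.d := hs.dist_r ▸ Int.fract_nonneg _
  unfold batchX
  by_cases htest : s.y ≤ shr (s.x - s.d) c
  · rw [if_pos htest]
    -- the test implies `y ≤ x − d`, so `⌊(x − d)/y⌋ ≥ 1`
    have hyxd : s.y ≤ s.x - s.d := by
      have h2c : (1 : K) ≤ 2 ^ c := one_le_pow₀ (by norm_num)
      have hnn : 0 ≤ s.x - s.d := by linarith [hs.d_lt]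
      calc s.y ≤ shr (s.x - s.d) c := htest
        _ = (s.x - s.d) / 2 ^ c := rfl
        _ ≤ (s.x - s.d) / 1 := by gcongr
        _ = s.x - s.d := div_one _
    set m := ⌊(s.x - s.d) / s.y⌋₊ with hm_def
    have hm1 : 1 ≤ m := by
      rw [hm_def, Nat.le_floor_iff (div_nonneg (by linarith) hy.le), le_div_iff₀ hy]; simpa using hyxd
    have hmle : (m : K) * s.y ≤ s.x - s.d := by
      have h := Nat.floor_le (div_nonneg (by linarith : (0 : K) ≤ s.x - s.d) hy.le)
      rw [← hm_def] at h; rwa [le_div_iff₀ hy] at h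
    -- hence `d < x − q·y` for every `q < m`, in particular `q = m − 1`
    have hroom : ∀ q : ℕ, q < m → s.d < s.x - (q : K) * s.y := fun q hq => by
      have : ((q : K) + 1) * s.y ≤ (m : K) * s.y := by
        have : (q : K) + 1 ≤ m := by exact_mod_cast hq
        nlinarith
      nlinarith
    by_cases hN : N ≤ m - 1
    · rw [if_pos hN]
      refine ⟨fun _ => ?_, fun t ht => by cases ht⟩
      -- `N − 1 ≤ q` rounds are legal; after them `u + v ≥ N` points are checked
      have hu := hs.cfg.u_pos
      have h := hs.roundX_iter (N - 1) (hroom _ (by omega))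
      have hmul := Nat.le_mul_of_pos_right (N - 1) hu
      exact returns_N_of_checked h.checked (by dsimp only; omega)
    · rw [if_neg hN]
      refine ⟨fun h => (by cases h), fun t ht => ?_⟩
      cases ht
      exact ⟨hs.roundX_iter (m - 1) (hroom _ (by omega)), rfl, by dsimp only; omega⟩
  · rw [if_neg htest]
    refine ⟨fun h => (by cases h), fun t ht => ?_⟩
    cases ht
    exact ⟨hs, rfl, le_rfl⟩

/-- The division replacing the first inner loop: returns `N` rightly, or exits with `XInv`, `y < x` or `y = x`
(`y ≤ x`), `d` unchanged, `u + v` not decreased — exactly the contract of `loopY_spec`.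
[cite: Lefevre2005, §3 Algorithm 2] -/
theorem divY_spec {s : State K} (hs : XInv a b d₀ s) :
    (divY c N s = none → Returns a b d₀ N N) ∧
    (∀ t, divY c N s = some t → XInv a b d₀ t ∧ t.y ≤ t.x ∧ t.d = s.d ∧ s.u + s.v ≤ t.u + t.v) := by
  have hx := hs.cfg.x_pos
  have hy := hs.cfg.y_pos
  unfold divY
  by_cases htest : c = 0 ∨ s.x < shr s.y c
  · rw [if_pos htest]
    set q := ⌊s.y / s.x⌋₊ with hq_def
    have hqle : (q : K) * s.x ≤ s.y := by
      have h := Nat.floor_le (div_nonneg hy.le hx.le); rw [← hq_def] at h; rwa [le_div_iff₀ hx] at h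
    have hq1 : s.y < ((q : K) + 1) * s.x := by
      have h := Nat.lt_floor_add_one (s.y / s.x); rw [← hq_def] at h; rwa [div_lt_iff₀ hx] at h
    by_cases hN : N ≤ q
    · rw [if_pos hN]
      refine ⟨fun _ => ?_, fun t ht => by cases ht⟩
      have hv := hs.cfg.v_pos
      have hlt : ((N - 1 : ℕ) : K) * s.x < s.y := by
        rcases Nat.eq_zero_or_pos N with hN0 | hNpos
        · subst hN0; simpa using hy
        · have : ((N - 1 : ℕ) : K) + 1 ≤ q := by exact_mod_cast (show N - 1 + 1 ≤ q by omega)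
          nlinarith
      have h := hs.stepY_iter (N - 1) hlt
      have hmul := Nat.le_mul_of_pos_right (N - 1) hv
      exact returns_N_of_checked h.checked (by dsimp only; omega)
    · rw [if_neg hN]
      by_cases hz : s.y - (q : K) * s.x = 0
      · rw [if_pos hz]
        refine ⟨fun _ => ?_, fun t ht => by cases ht⟩
        -- `y = q·x`: after `q − 1` legal iterations both lengths are equal; the split is then degenerate
        have hq1' : 1 ≤ q := by
          by_contra h0
          have : q = 0 := by omega
          rw [this] at hz; simp at hz; linarith
        have hlt : ((q - 1 : ℕ) : K) * s.x < s.y := by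
          have e : ((q - 1 : ℕ) : K) = (q : K) - 1 := by push_cast [Nat.cast_sub hq1']; ring
          rw [e]; nlinarith
        have h := hs.stepY_iter (q - 1) hlt
        have heq : s.y - ((q - 1 : ℕ) : K) * s.x = s.x := by
          have e : ((q - 1 : ℕ) : K) = (q : K) - 1 := by push_cast [Nat.cast_sub hq1']; ring
          rw [e]; linarith
        have hdeg := h.split_degenerate (by dsimp only; rw [heq])
        exact ⟨fun h' => absurd h' (lt_irrefl _), fun k _ _ => hdeg.all_checked k⟩
      · rw [if_neg hz]
        refine ⟨fun h => (by cases h), fun t ht => ?_⟩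
        cases ht
        have hlt : (q : K) * s.x < s.y := lt_of_le_of_ne hqle (fun e => hz (by rw [e, sub_self]))
        exact ⟨hs.stepY_iter q hlt, by dsimp only; linarith, rfl, by dsimp only; omega⟩
  · rw [if_neg htest]
    obtain ⟨h1, h2⟩ := loopY_spec N N s hs (by omega)
    exact ⟨fun h => ⟨fun h' => absurd h' (lt_irrefl _), fun k hk _ => h1 h k hk⟩, h2⟩

/-- The division replacing the second inner loop, symmetrically (contract of `loopX_spec`).
[cite: Lefevre2005, §3 Algorithm 2] -/
theorem divX_spec {s : State K} (hs : YInv a b d₀ s) :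
    (divX c N s = none → Returns a b d₀ N N) ∧
    (∀ t, divX c N s = some t → YInv a b d₀ t ∧ t.x ≤ t.y ∧ t.d = s.d ∧ s.u + s.v ≤ t.u + t.v) := by
  have hx := hs.cfg.x_pos
  have hy := hs.cfg.y_pos
  unfold divX
  by_cases htest : c = 0 ∨ s.y < shr s.x c
  · rw [if_pos htest]
    set q := ⌊s.x / s.y⌋₊ with hq_def
    have hqle : (q : K) * s.y ≤ s.x := by
      have h := Nat.floor_le (div_nonneg hx.le hy.le); rw [← hq_def] at h; rwa [le_div_iff₀ hy] at h
    have hq1 : s.x < ((q : K) + 1) * s.y := by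
      have h := Nat.lt_floor_add_one (s.x / s.y); rw [← hq_def] at h; rwa [div_lt_iff₀ hy] at h
    by_cases hN : N ≤ q
    · rw [if_pos hN]
      refine ⟨fun _ => ?_, fun t ht => by cases ht⟩
      have hu := hs.cfg.u_pos
      have hlt : ((N - 1 : ℕ) : K) * s.y < s.x := by
        rcases Nat.eq_zero_or_pos N with hN0 | hNpos
        · subst hN0; simpa using hx
        · have : ((N - 1 : ℕ) : K) + 1 ≤ q := by exact_mod_cast (show N - 1 + 1 ≤ q by omega)
          nlinarith
      have h := hs.stepX_iter (N - 1) hlt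
      have hmul := Nat.le_mul_of_pos_right (N - 1) hu
      exact returns_N_of_checked h.checked (by dsimp only; omega)
    · rw [if_neg hN]
      by_cases hz : s.x - (q : K) * s.y = 0
      · rw [if_pos hz]
        refine ⟨fun _ => ?_, fun t ht => by cases ht⟩
        have hq1' : 1 ≤ q := by
          by_contra h0
          have : q = 0 := by omega
          rw [this] at hz; simp at hz; linarith
        have hlt : ((q - 1 : ℕ) : K) * s.y < s.x := by
          have e : ((q - 1 : ℕ) : K) = (q : K) - 1 := by push_cast [Nat.cast_sub hq1']; ring
          rw [e]; nlinarith
        have h := hs.stepX_iter (q - 1) hlt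
        have heq : s.x - ((q - 1 : ℕ) : K) * s.y = s.y := by
          have e : ((q - 1 : ℕ) : K) = (q : K) - 1 := by push_cast [Nat.cast_sub hq1']; ring
          rw [e]; linarith
        have hdeg := h.split_degenerate (by dsimp only; rw [heq])
        exact ⟨fun h' => absurd h' (lt_irrefl _), fun k _ _ => hdeg.all_checked k⟩
      · rw [if_neg hz]
        refine ⟨fun h => (by cases h), fun t ht => ?_⟩
        cases ht
        have hlt : (q : K) * s.y < s.x := lt_of_le_of_ne hqle (fun e => hz (by rw [e, sub_self]))
        exact ⟨hs.stepX_iter q hlt, by dsimp only; linarith, rfl, by dsimp only; omega⟩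
  · rw [if_neg htest]
    obtain ⟨h1, h2⟩ := loopX_spec N N s hs (by omega)
    exact ⟨fun h => ⟨fun h' => absurd h' (lt_irrefl _), fun k hk _ => h1 h k hk⟩, h2⟩

/-- One round of Algorithm 2 from a `HeadInv` state: a returned value satisfies `Returns`; otherwise the next
head state satisfies `HeadInv` (Algorithm 2 never CONTINUES after a length vanished: the tests `x = 0`, `y = 0`
return `N` first), and `u + v` has increased from a value `< N`. [cite: Lefevre2005, §3 Algorithm 2] -/
theorem body2_spec_head {s : State K} (hs : HeadInv a b d₀ s) :
    (∀ res, body2 c d₀ N s = Sum.inl res → Returns a b d₀ N res) ∧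
    (∀ t, body2 c d₀ N s = Sum.inr t →
      (HeadInv a b d₀ t ∨ Degenerate a b d₀ t) ∧ s.u + s.v < N ∧ s.u + s.v < t.u + t.v) := by
  by_cases hdx : s.d < s.x
  · -- the x-branch
    obtain ⟨hr, hdist, hchk⟩ := hs.inX hdx
    have hX : XInv a b d₀ s := ⟨hs.cfg, hs.d₀_le, hdx, hr, hdist, hchk⟩
    obtain ⟨hbn, hbs⟩ := batchX_spec (c := c) (N := N) hX
    cases hb : batchX c N s with
    | none =>
      simp only [body2, hdx, if_true, hb]
      exact ⟨fun res hres => by cases hres; exact hbn hb, fun t ht => by cases ht⟩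
    | some s₁ =>
      obtain ⟨hX1, hd1, hsum1⟩ := hbs s₁ hb
      obtain ⟨hdn, hds⟩ := divY_spec (c := c) (N := N) hX1
      cases hl : divY c N s₁ with
      | none =>
        simp only [body2, hdx, if_true, hb, hl]
        exact ⟨fun res hres => by cases hres; exact hdn hl, fun t ht => by cases ht⟩
      | some t =>
        obtain ⟨ht, hyx, -, hsum⟩ := hds t hl
        simp only [body2, hdx, if_true, hb, hl]
        by_cases hN : N ≤ t.u + t.v
        · simp only [hN, if_true]
          refine ⟨fun res hres => ?_, fun t ht => by cases ht⟩
          cases hres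
          exact returns_N_of_checked ht.checked hN
        · simp only [hN, if_false]
          by_cases hz : t.x - t.y = 0
          · simp only [hz, if_true]
            refine ⟨fun res hres => ?_, fun t' ht' => by cases ht'⟩
            cases hres
            have hdeg := ht.split_degenerate (by linarith : t.y = t.x)
            exact ⟨fun h' => absurd h' (lt_irrefl _), fun k _ _ => hdeg.all_checked k⟩
          · simp only [hz, if_false]
            refine ⟨fun res hres => (by cases hres), fun t' ht' => ?_⟩
            cases ht'
            refine ⟨?_, by omega, by have := ht.cfg.u_pos; dsimp only; omega⟩
            have hlt : t.y < t.x := lt_of_le_of_ne hyx (fun e => hz (by rw [e, sub_self]))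
            exact Or.inl (ht.split hlt)
  · -- the else-branch
    have hxd : s.x ≤ s.d := not_lt.1 hdx
    obtain ⟨hdxy, hr, hdist, hchk⟩ := hs.inY hxd
    by_cases hfound : s.d - s.x < d₀
    · simp only [body2, hdx, if_false, hfound, if_true]
      refine ⟨fun res hres => ?_, fun t ht => by cases ht⟩
      cases hres
      refine ⟨fun _ => ?_, fun k hk hkr => hchk k (by omega) (by omega)⟩
      have ei : ((s.r + s.u : ℕ) : K) = ((s.u + s.r : ℕ) : K) := by rw [Nat.add_comm]
      rw [ei, hdist]; exact hfound
    · have hY : YInv a b d₀ { s with d := s.d - s.x } := by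
        refine ⟨hs.cfg, not_lt.1 hfound, by dsimp only; linarith, hr, hdist, fun k hk => ?_⟩
        dsimp only at hk
        by_cases hkr : k = s.u + s.r
        · rw [hkr, hdist]; exact not_lt.1 hfound
        · exact hchk k hk hkr
      obtain ⟨hdn, hds⟩ := divX_spec (c := c) (N := N) hY
      cases hl : divX c N { s with d := s.d - s.x } with
      | none =>
        simp only [body2, hdx, if_false, hfound, hl]
        exact ⟨fun res hres => by cases hres; exact hdn hl, fun t ht => by cases ht⟩
      | some t =>
        obtain ⟨ht, hxy, -, hsum⟩ := hds t hl
        dsimp only at hsum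
        simp only [body2, hdx, if_false, hfound, hl]
        by_cases hN : N ≤ t.u + t.v
        · simp only [hN, if_true]
          refine ⟨fun res hres => ?_, fun t ht => by cases ht⟩
          cases hres
          exact returns_N_of_checked ht.checked hN
        · simp only [hN, if_false]
          by_cases hz : t.y - t.x = 0
          · simp only [hz, if_true]
            refine ⟨fun res hres => ?_, fun t' ht' => by cases ht'⟩
            cases hres
            have hdeg := ht.split_degenerate (by linarith : t.x = t.y)
            exact ⟨fun h' => absurd h' (lt_irrefl _), fun k _ _ => hdeg.all_checked k⟩
          · simp only [hz, if_false]
            refine ⟨fun res hres => (by cases hres), fun t' ht' => ?_⟩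
            cases ht'
            refine ⟨?_, by omega, by have := ht.cfg.v_pos; dsimp only; omega⟩
            have hlt : t.x < t.y := lt_of_le_of_ne hxy (fun e => hz (by rw [e, sub_self]))
            exact Or.inl (ht.split hlt)

/-- One round of Algorithm 2 from a `Degenerate` state (only reachable from the initialisation with
`{a} = 0`, every other vanishing length being caught by the tests `x = 0` / `y = 0`): it returns `N`
(rightly) or stays degenerate with `u + v` increased. [cite: Lefevre2005, §2.4, §3 Algorithm 2] -/
theorem body2_spec_degenerate {s : State K} (hs : Degenerate a b d₀ s) :
    (∀ res, body2 c d₀ N s = Sum.inl res → Returns a b d₀ N res) ∧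
    (∀ t, body2 c d₀ N s = Sum.inr t →
      (HeadInv a b d₀ t ∨ Degenerate a b d₀ t) ∧ s.u + s.v < N ∧ s.u + s.v < t.u + t.v) := by
  have hret : Returns a b d₀ N N :=
    ⟨fun h => absurd h (lt_irrefl _), fun k _ _ => hs.all_checked k⟩
  -- every `Sum.inl` result of `body2` from this state is `N` or unreachable; we analyse the two shapes
  rcases hs.shape with ⟨hx, hy⟩ | ⟨hy, hdx⟩
  · -- x = 0: the else-branch; its d₀-test fails; `divX` divides by... compares only: q = ⌊0/y⌋ = 0, then x = 0 ⇒ N,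
    -- or (c > 0) the subtractive loop does nothing and the round continues degenerate
    have hndx : ¬ s.d < s.x := by rw [hx]; exact not_lt.2 hs.d_nonneg
    have hnf : ¬ s.d - s.x < d₀ := by rw [hx, sub_zero]; exact not_lt.2 hs.d₀_le
    simp only [body2, hndx, if_false, hnf]
    cases hl : divX c N { s with d := s.d - s.x } with
    | none =>
      simp only
      exact ⟨fun res hres => by cases hres; exact hret, fun t ht => by cases ht⟩
    | some t =>
      simp only
      -- in the `some` case the division path was not taken with a change: t = s (d shifted)
      have ht : t = { s with d := s.d - s.x } := by
        unfold divX at hl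
        split_ifs at hl with h1 h2 h3
        · cases hl; simp [hx, Nat.floor_zero]
        · rw [loopX_of_not_lt N N (by dsimp only; rw [hx]; exact not_lt.2 hy)] at hl
          cases hl; rfl
      subst ht
      dsimp only
      by_cases hN : N ≤ s.u + s.v
      · simp only [hN, if_true]
        exact ⟨fun res hres => by cases hres; exact hret, fun t ht => by cases ht⟩
      · simp only [hN, if_false]
        by_cases hz : s.y - s.x = 0
        · simp only [hz, if_true]
          exact ⟨fun res hres => by cases hres; exact hret, fun t ht => by cases ht⟩
        · simp only [hz, if_false]
          refine ⟨fun res hres => (by cases hres), fun t ht => ?_⟩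
          cases ht
          refine ⟨Or.inr ⟨hs.all_checked, ?_, ?_, ?_, hs.v_pos, Or.inl ⟨hx, ?_⟩⟩, by omega,
            by have := hs.v_pos; dsimp only; omega⟩
          · dsimp only; rw [hx, sub_zero]; exact hs.d₀_le
          · dsimp only; rw [hx, sub_zero]; exact hs.d_nonneg
          · exact Nat.add_pos_left hs.u_pos _
          · dsimp only; rw [hx, sub_zero]; exact hy
  · -- y = 0: the x-branch; the first block and the division change nothing or return N
    have hxpos : 0 < s.x := lt_of_le_of_lt hs.d_nonneg hdx
    simp only [body2, hdx, if_true]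
    -- batchX: the test reads `0 ≤ …` (true), q = ⌊(x − d)/0⌋ − 1 = 0
    have hb : batchX c N s = (if N ≤ 0 then none else some s) := by
      unfold batchX
      have h0 : ⌊(s.x - s.d) / s.y⌋₊ - 1 = 0 := by rw [hy, div_zero, Nat.floor_zero]
      have htest : s.y ≤ shr (s.x - s.d) c := by
        rw [hy]; exact div_nonneg (by linarith) (by positivity)
      rw [if_pos htest, h0]
      split_ifs <;> simp
    rcases Nat.eq_zero_or_pos N with hN0 | hNpos
    · subst hN0
      rw [hb]; simp only [le_refl, if_true]
      exact ⟨fun res hres => by cases hres; exact hret, fun t ht => by cases ht⟩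
    · rw [hb, if_neg (by omega)]
      simp only
      cases hl : divY c N s with
      | none =>
        simp only
        exact ⟨fun res hres => by cases hres; exact hret, fun t ht => by cases ht⟩
      | some t =>
        simp only
        have ht : t = s := by
          unfold divY at hl
          split_ifs at hl with h1 h2 h3
          · exfalso; apply h3; simp [hy, Nat.floor_zero]
          · rw [loopY_of_not_lt N N (by rw [hy]; exact not_lt.2 hxpos.le)] at hl
            cases hl; rfl
        subst ht
        by_cases hN : N ≤ t.u + t.v
        · simp only [hN, if_true]
          exact ⟨fun res hres => by cases hres; exact hret, fun t ht => by cases ht⟩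
        · simp only [hN, if_false]
          have hz : ¬ t.x - t.y = 0 := by rw [hy, sub_zero]; exact hxpos.ne'
          simp only [hz, if_false]
          refine ⟨fun res hres => (by cases hres), fun t' ht' => ?_⟩
          cases ht'
          refine ⟨Or.inr ⟨hs.all_checked, hs.d₀_le, hs.d_nonneg, hs.u_pos, ?_, Or.inr ⟨hy, ?_⟩⟩,
            by omega, by have := hs.u_pos; dsimp only; omega⟩
          · exact Nat.add_pos_left hs.v_pos _
          · dsimp only; rw [hy, sub_zero]; exact hdx

/-- **The unconditional loop of Algorithm 2 is correct** from any `HeadInv` or `Degenerate` state, given an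
iteration bound `> N − (u + v)`. [cite: Lefevre2005, §3 Algorithm 2] -/
theorem loop2_spec : ∀ (fuel : ℕ) (s : State K), (HeadInv a b d₀ s ∨ Degenerate a b d₀ s) →
    N - (s.u + s.v) < fuel → Returns a b d₀ N (loop2 c d₀ N fuel s)
  | 0, _, _, hf => absurd hf (Nat.not_lt_zero _)
  | fuel + 1, s, hs, hf => by
    have hb := hs.elim (fun h => body2_spec_head (c := c) (N := N) h)
      (fun h => body2_spec_degenerate (c := c) (N := N) h)
    simp only [loop2]
    cases hbody : body2 c d₀ N s with
    | inl res => simpa using hb.1 res hbody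
    | inr t =>
      obtain ⟨ht, h1, h2⟩ := hb.2 t hbody
      exact loop2_spec fuel t ht (by omega)

/-- **Theorem (Lefèvre 2005, Algorithm 2 is correct; any shift count `c`, no side condition).** Let
`r = algorithm2 c a b d₀ N`. If `r < N` then `{b − r·a} < d₀`; and `{b − k·a} ≥ d₀` for every `k < N` with
`k < r` — "still returns the first integer `r ∈ ⟦0, N − 1⟧` such that `{b − r·a} < d₀` if there is one, else a
value larger or equal to `N`". [cite: Lefevre2005, §3 Algorithm 2] -/
theorem algorithm2_spec (c : ℕ) (a b d₀ : K) (N : ℕ) :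
    (algorithm2 c a b d₀ N < N → Int.fract (b - (algorithm2 c a b d₀ N) * a) < d₀) ∧
    ∀ k : ℕ, k < N → k < algorithm2 c a b d₀ N → d₀ ≤ Int.fract (b - k * a) := by
  have key : Returns a b d₀ N (algorithm2 c a b d₀ N) := by
    unfold algorithm2
    split_ifs with hb
    · exact ⟨fun _ => by simpa using hb, fun k _ hk => absurd hk (Nat.not_lt_zero _)⟩
    · have hb' : d₀ ≤ Int.fract b := not_lt.1 hb
      rcases Nat.eq_zero_or_pos N with rfl | hN
      · exact ⟨fun h => absurd h (Nat.not_lt_zero _), fun k hk => absurd hk (Nat.not_lt_zero _)⟩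
      · refine loop2_spec N _ ?_ (by show N - (1 + 1) < N; omega)
        by_cases ha : Int.fract a = 0
        · exact Or.inr (degenerate_init hb' ha)
        · exact Or.inl (headInv_init hb' ha)
  exact ⟨key.found, key.first⟩

/-- The no-point test with Algorithm 2: a value `≥ N` iff no `k < N` has `{b − k·a} < d₀`.
[cite: Lefevre2005, §3 Algorithm 2] -/
theorem le_algorithm2_iff (c : ℕ) (a b d₀ : K) (N : ℕ) :
    N ≤ algorithm2 c a b d₀ N ↔ ∀ k : ℕ, k < N → d₀ ≤ Int.fract (b - k * a) := by
  obtain ⟨h1, h2⟩ := algorithm2_spec c a b d₀ N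
  constructor
  · exact fun h k hk => h2 k hk (lt_of_lt_of_le hk h)
  · intro h
    by_contra hlt
    exact absurd (h _ (not_le.1 hlt)) (not_le.2 (h1 (not_le.1 hlt)))

/-- "We checked that the output did not depend on the parameters" [Lefevre2005, §4]: Algorithms 1 and 2 agree
on the verdict (and, below `N`, on the returned index, both being the FIRST one). [cite: Lefevre2005, §4] -/
theorem algorithm2_ge_iff_algorithm1_ge (c : ℕ) (a b d₀ : K) (N : ℕ) :
    N ≤ algorithm2 c a b d₀ N ↔ N ≤ algorithm1 a b d₀ N := by
  rw [le_algorithm2_iff, le_algorithm1_iff]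

/-- Below `N` both algorithms return the same (first) index. [cite: Lefevre2005, §4] -/
theorem algorithm2_eq_algorithm1_of_lt (c : ℕ) (a b d₀ : K) (N : ℕ) (h : algorithm1 a b d₀ N < N) :
    algorithm2 c a b d₀ N = algorithm1 a b d₀ N := by
  obtain ⟨h1, h1'⟩ := algorithm1_lt_imp a b d₀ N h
  obtain ⟨g1, g2⟩ := algorithm2_spec c a b d₀ N
  have h2lt : algorithm2 c a b d₀ N < N := by
    by_contra hge
    exact absurd h1 (not_lt.2 ((le_algorithm2_iff c a b d₀ N).1 (not_lt.1 hge) _ h))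
  rcases lt_trichotomy (algorithm2 c a b d₀ N) (algorithm1 a b d₀ N) with hlt | heq | hgt
  · exact absurd (g1 h2lt) (not_lt.2 (h1' _ hlt))
  · exact heq
  · exact absurd h1 (not_lt.2 (g2 _ h hgt))

end Spec

/-! ### Evaluation -/

/-- The examples of `SegmentGrid`, now through Algorithm 2 (`c = 0`: divisions forced): first index `379`…
[cite: Lefevre2005, §3 Algorithm 2] -/
example : algorithm2 0 (355 / 1137 : ℚ) (1 / 3) (1 / 5000) 1000 = 379 := by decide +kernel

/-- … and with the shift test `c = 3`. [cite: Lefevre2005, §3 Algorithm 2] -/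
example : algorithm2 3 (355 / 1137 : ℚ) (1 / 3) (1 / 5000) 1000 = 379 := by decide +kernel

/-- The `2^16`-point sub-domain with 64-bit data: no point within the window (value `≥ 2^16`).
[cite: Lefevre2005, §3 Algorithm 2] -/
example : 2 ^ 16 ≤ algorithm2 0 (0x9E3779B97F4A7C15 / 2 ^ 64 : ℚ) (0x243F6A8885A308D3 / 2 ^ 64 + 1 / 2 ^ 31)
    (2 * (1 / 2 ^ 31)) (2 ^ 16) := by
  decide +kernel

/-- A slope whose fractional part is tiny (`{a} = 2^-40`, first partial quotient `2^40`): the subtractive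
Algorithm 1 would walk `while (x < y)` for `N` steps before answering; Algorithm 2 answers `N` with ONE
division (`q = ⌊y/x⌋ = 2^40 − 1 ≥ N`). [cite: Lefevre2005, §3] -/
example : 2 ^ 20 ≤ algorithm2 0 (1 / 2 ^ 40 : ℚ) (1 / 2 ^ 50) (1 / 2 ^ 60) (2 ^ 20) := by decide +kernel

end Literature.ComputerArithmetic.Lefevre2005
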